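import Summits.QuantumFields.Balaban3D.Proofs.FamilyLE
import Summits.QuantumFields.Balaban3D.Proofs.AlphaAdaptersAC
import Summits.QuantumFields.Balaban3D.Proofs.LeavesOldAC

/-!
# Bałaban CMP 102 (1985), d = 3 lane — `Proofs.Thm2AC`: **THEOREM 2 ((41) ∧ (47) for every `k ≤ K`) FOR THE AC TOWER** — the densities
# `ρ_k = T^kρ₀` of the lane's tower over an averaging that is merely ABSOLUTELY CONTINUOUS (`StandardAC.ExternalInputsAC`, uncapped
# Radon–Nikodym masses) satisfy the inductive inequalities (41) p. 266 and (47) p. 267, from the (α) input package `AlphaAC.RunAlphaAC` on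
# the `≤`-family `g²ε₀ ≤ (min γ₀ 1)²` — lane `pub-balaban3d`, seat alpha-1 (LINE 2 of the definition request `defn-AlphaInputsT3AC`, route
# `UnitScaleTilt`; the socket `Summits/QuantumFields/YangMills/Theorems/AlphaInputsT3AC` instantiates this at the T³ family's `blockAvg ℰp`)

THE CHAIN (seat p3's `Residuals`/`UVStability3DInputs`/`FamilyLE` at the AC objects): the nine RESIDUAL step leaves `StepResidualsAC` at
`InputsAC.piecesAC` ⇒ the fourteen `B10SectAGathering.StepLeaves` (`stepLeavesOfAC`: C9/C13/C14 from `InputsAC`, C11/C12 by `rfl`) ⇒ with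
(1)₀ (`step0_towerOfAC`, seat p4's `Step0Tower.step0_pin`) and the coupling window `0 < g_k ≤ 1` LQB's `thm2_of_leaves` ⇒ (41) ∧ (47)
(`ineq41_47_of_residualsAC`, through `InputsAC.specOK_towerOfAC`).  The residual leaves from the (α) rows: `stepResidualsAC_of_alpha_le`
(C1/C2 by `Bound55AC` — the transport step (48)–(49) under `AvgAC` with the exact masses, finding F-α1-1; C3–C8 by the AC twins of the series
leaves; thresholds from `FamilyLE.thresholds_of_le`) — EXCEPT C10 `oldOutside` (p. 272 L28–31), whose provider `Run3OldOutside` is not yet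
twinned over the AC carriers: it enters `ineq41_47_of_alphaAC_le` as ONE explicit residual hypothesis `hOO`, discharged in §3 by
`LeavesOldAC` (`oldOutside_piecesAC`, `ineq41_47_of_alphaAC`: Theorem 2 from the (α) rows alone).  Theorem 1 ((5)) is NOT derived here (its large-field leaf `lf` uses `mass ≤ 1`; over `AvgAC` it needs a k-fold Jacobian
bound, located-unprinted).  HONEST FRAMING (lane PLAN.md §0): UV stability bookkeeping on a finite torus as printed, modulo the (α) rows;
nothing of CMP 102's analysis is asserted.
-/

noncomputable section

namespace Summit.QuantumFields.Balaban3D.Proofs.Thm2AC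

open MeasureTheory Metric
open scoped BigOperators
open Literature.MathematicalPhysics.QuantumFieldTheory.Balaban1983to89
open Literature.MathematicalPhysics.QuantumFieldTheory.Balaban1983to89.B10
open Literature.MathematicalPhysics.QuantumFieldTheory.Balaban1983to89.B10SectAGathering
open Literature.MathematicalPhysics.QuantumFieldTheory.Balaban1983to89.TreeLengthTorus (tsys)
open Literature.MathematicalPhysics.QuantumFieldTheory.Balaban1985CMP102
open Literature.MathematicalPhysics.QuantumFieldTheory.Balaban1985CMP102.Setting
open Literature.MathematicalPhysics.QuantumFieldTheory.Balaban1985CMP102.SectB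
open Summit.QuantumFields.Balaban3D.Carriers
open Summit.QuantumFields.Balaban3D.Proofs.ScalesArithmetic
open Summit.QuantumFields.Balaban3D.Proofs.Inputs
open Summit.QuantumFields.Balaban3D.Proofs.Primitives
open Summit.QuantumFields.Balaban3D.Proofs.UVStability3DInputs (lieChart adjAct hdet_adjAct)
open Summit.QuantumFields.Balaban3D.Proofs.GroupModelLieC (lieC)
open Summit.QuantumFields.Balaban3D.Proofs.FamilyLE (thresholds_of_le)
open Summit.QuantumFields.Balaban3D.Proofs.TowerAC
open Summit.QuantumFields.Balaban3D.Proofs.SeriesAC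
open Summit.QuantumFields.Balaban3D.Proofs.StandardAC
open Summit.QuantumFields.Balaban3D.Proofs.InputsAC
open Summit.QuantumFields.Balaban3D.Proofs.Bound55AC
open Summit.QuantumFields.Balaban3D.Proofs.AlphaAC
open Summit.QuantumFields.Balaban3D.Proofs.AlphaAdaptersAC

variable {L : ℕ}

/-! ## §1 The residual step leaves at the AC pieces and Theorem 2 from them -/

section Residuals

variable (𝔎 : LaneConsts L) {S : Scales L} {G : Type} [GaugeGroup G] [MeasurableSpace G] [HaarData G]
  {V : Type} [NormedAddCommGroup V] [NormedSpace ℂ V]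
  (X : ExternalInputsAC S G) (𝔖 : ∀ k, StepSeries S G V (nblkOf S 𝔎.carrier k) k)

/-- **THE RESIDUAL STEP LEAVES of step `k → k+1` AT THE AC PIECES** — seat p3's `Residuals.StepResiduals` with `pieces ↦ piecesAC`: the nine
analytic leaves C1–C8, C10 of LQB's `StepLeaves` at `InputsAC.piecesAC 𝔎 X 𝔖 k` with the record's constants.  HYPOTHESES; nothing asserted.
[cite: Balaban1985UV3, (55)–(61) pp.269–271 + p.272] -/
structure StepResidualsAC (k : ℕ) : Prop where
  /-- C1: (22)/(55) -/
  bound55 : Bound55 (piecesAC 𝔎 X 𝔖 k)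
  /-- C2: lower twin of (22)/(55) at the trivial history -/
  bound55Lower : Bound55Lower (piecesAC 𝔎 X 𝔖 k)
  /-- C3: (24)/(58)–(59) -/
  cumulant58 : Cumulant58 (piecesAC 𝔎 X 𝔖 k) 𝔎.sc.Cz 𝔎.sc.C₁
  /-- C4: lower cumulant direction -/
  cumulantLower : CumulantLower (piecesAC 𝔎 X 𝔖 k) 𝔎.sc.C₁'
  /-- C5: (33)/(60) -/
  repr33_60 : Repr33_60 (piecesAC 𝔎 X 𝔖 k) 𝔎.sc.C₂
  /-- C6: whole-lattice vacuum sum -/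
  vacuumWhole : VacuumWhole (piecesAC 𝔎 X 𝔖 k) 𝔎.sc.Cv 𝔎.sc.C₃
  /-- C7: (35)/(61) -/
  decomp35_61 : Decomp35_61 (piecesAC 𝔎 X 𝔖 k) 𝔎.sc.C₄
  /-- C8: (35) normalisation -/
  norm35 : Norm35 (piecesAC 𝔎 X 𝔖 k) 𝔎.sc.C₅
  /-- C10: old terms outside Ω_{k+1}, p. 272 -/
  oldOutside : OldOutside (piecesAC 𝔎 X 𝔖 k) 𝔎.sc.C₆

variable {𝔎 X 𝔖}

/-- **THE FOURTEEN STEP LEAVES AT THE AC PIECES** from the nine residual ones (`c₁ := 3`; C9/C13/C14 from `InputsAC`, C11/C12 by `rfl`).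
[cite: Balaban1985UV3, (55)–(62) pp.269–271] -/
def stepLeavesOfAC (k : ℕ) (hk : k + 1 ≤ S.K) (R : StepResidualsAC 𝔎 X 𝔖 k) : StepLeaves (towerOfAC 𝔎 X 𝔖) k where
  P := piecesAC 𝔎 X 𝔖 k
  Cz := 𝔎.sc.Cz
  C₁ := 𝔎.sc.C₁
  C₁' := 𝔎.sc.C₁'
  C₂ := 𝔎.sc.C₂
  Cv := 𝔎.sc.Cv
  C₃ := 𝔎.sc.C₃
  C₄ := 𝔎.sc.C₄
  C₅ := 𝔎.sc.C₅
  c₁ := 3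
  C₆ := 𝔎.sc.C₆
  bound55 := R.bound55
  bound55Lower := R.bound55Lower
  cumulant58 := R.cumulant58
  cumulantLower := R.cumulantLower
  repr33_60 := R.repr33_60
  vacuumWhole := R.vacuumWhole
  decomp35_61 := R.decomp35_61
  norm35 := R.norm35
  starCount := starCount_piecesAC 𝔎 X 𝔖 k hk
  oldOutside := R.oldOutside
  pintSucc := (X.toTowerBase 𝔎.carrier).pintSucc_seriesAC _ _ k
  estep62 := (X.toTowerBase 𝔎.carrier).estep62_seriesAC _ _ k
  ztermSucc := ztermSucc_piecesAC 𝔎 X 𝔖 k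
  rmSucc := rmSucc_piecesAC 𝔎 X 𝔖 k

variable (𝔎 X 𝔖)

/-- **(41)₀ ∧ (47)₀ FOR THE AC TOWER** ((1) p. 256: one history with `LF 0 V F = exp (F triv)` (`TowerAC.lfAC_zero`), `U₀ = id` (R-K0), `Pint 0 ≡ 0`
(the series' `Pint`)) — seat p4's `Step0Tower.step0_pin`. [cite: Balaban1985UV3, (1) p.256] -/
theorem step0_towerOfAC : Step0Printed (towerOfAC 𝔎 X 𝔖) :=
  Step0Tower.step0_pin (towerWAC 𝔎 X 𝔖) (fun V F => lfAC_zero (inputOfAC 𝔎 X 𝔖).W V F)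
    (fun V => by
      show (run3 ((inputOfAC 𝔎 X 𝔖).toRunInput fun _ => True)).Uk 0 V = V
      rw [TowerInputAC.ukAll_eq]; rfl)
    (fun _ _ => rfl)

/-- **THEOREM 2 FOR THE AC TOWER FROM THE RESIDUAL LEAVES**: if the nine residual step leaves hold at the AC pieces for every `k < K`, then
`(41)_k ∧ (47)_k` for every `k ≤ K` — LQB's `thm2_of_leaves` on the one-member family, the coupling window `0 < g_k ≤ 1` (`ScalesArithmetic`),
(1)₀ (`step0_towerOfAC`), and the slot pinning `InputsAC.specOK_towerOfAC`. [cite: Balaban1985UV3, Thm 2 p.272] -/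
theorem ineq41_47_of_residualsAC (R : ∀ k, k + 1 ≤ S.K → StepResidualsAC 𝔎 X 𝔖 k) (k : ℕ) (hk : k ≤ S.K) :
    Ineq41 (towerOfAC 𝔎 X 𝔖) k ∧ Ineq47 (towerOfAC 𝔎 X 𝔖) k := by
  have h2 := thm2_of_leaves (I := Unit) (fun _ => towerOfAC 𝔎 X 𝔖) (fun _ => specOK_towerOfAC 𝔎 X 𝔖)
    (fun _ => step0_towerOfAC 𝔎 X 𝔖)
    (fun _ j hj => ⟨gk_pos S j, gk_le_one S S.gK_le_one j (by have hj' : j + 1 ≤ S.K := hj; omega)⟩)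
    (fun _ j hj => stepLeavesOfAC j hj (R j hj))
  exact (specOK_towerOfAC 𝔎 X 𝔖 k).mp (h2 () k hk)

end Residuals

/-! ## §2 The residual leaves from the (α) rows on the `≤`-family (C10 as an explicit residual) -/

section Alpha

variable {S : Scales L} {G : Type} [GaugeGroup G] [MeasurableSpace G] [HaarData G] {𝔊 : GroupModel G} {𝔠 : AlphaConsts L 𝔊.N}
  {X : ExternalInputsAC S G} {𝔖 : ∀ k, StepSeries S G ↥(lieC 𝔊) (nblkOf S 𝔠.lane.carrier k) k} {𝔄 : AlphaDataAC 𝔊 𝔠 X 𝔖}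
  (hle : S.g ^ 2 * S.ε₀ ≤ (min 𝔠.gamma0 1) ^ 2)
include hle

/-- **(25) FOR THE ACTIVITIES from G3D-01 + (28)** at the AC pieces on the `≤`-family (seat p3's `FamilyLE.bound25_act_of_le`, p6's
`ChartFromBound25.bound25_real_of_chart` at the AC tower). [cite: Balaban1985UV3, (25) p.262 + (28)–(29) p.263] -/
theorem bound25_actAC_of_le (k : ℕ) (hk : k + 1 ≤ S.K) (A : StepAlphaAC 𝔊 𝔠 X 𝔖 𝔄 k) (h : Hist S.P (k + 1)) :
    Bound25Printed ⟨(tsys 3 (nblkOf S 𝔠.lane.carrier k)).Dom, GaugeField S.P (k + 1) G, (tsys 3 (nblkOf S 𝔠.lane.carrier k)).dj,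
      (𝔖 k).act h⟩ (S.gk k) 𝔠.κ 𝔠.C25 :=
  ChartFromBound25.bound25_real_of_chart (T := towerOfAC 𝔠.lane X 𝔖) (k := k) (𝔖 k).Ψ A.chart (𝔖 k).Bcfg A.bound28
    (thresholds_of_le hle k (by omega)).2.2.2.2 h

/-- **THE RESIDUAL STEP LEAVES AT THE AC PIECES FROM THE (α) STEP INPUTS on the `≤`-family, modulo C10** (seat p3's
`FamilyLE.stepResiduals_of_alpha_le` at the AC objects): C1/C2 by `Bound55AC` through `AlphaAdaptersAC.bound55_piecesAC/…Lower…` (transport under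
`AvgAC`, exact masses, residuals `Fibre49AC`/`Fibre57LowAC`), C3–C8 by the AC series leaves, thresholds from `g_k ≤ γ₀`; C10 `oldOutside` is the
explicit hypothesis `hOO`. [cite: Balaban1985UV3, (55)–(61) pp.269–271 + p.272] -/
theorem stepResidualsAC_of_alpha_le (k : ℕ) (hk : k + 1 ≤ S.K) (A : StepAlphaAC 𝔊 𝔠 X 𝔖 𝔄 k)
    (hOO : OldOutside (piecesAC 𝔠.lane X 𝔖 k) 𝔠.lane.sc.C₆) : StepResidualsAC 𝔠.lane X 𝔖 k := by
  haveI : RegularGaugeGroup G := groupModel_regularGaugeGroup 𝔊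
  exact
  { bound55 := bound55_piecesAC 𝔠.lane X 𝔖 k hk
      (hint_stdAC X 𝔠.lane.carrier 𝔖 (fun _ => True) k A.hU A.hPm (𝔄.cP k) A.hPb) A.fibre49
    bound55Lower := bound55Lower_piecesAC 𝔠.lane X 𝔖 k
      (hint47_stdAC X 𝔠.lane.carrier 𝔖 (fun _ => True) k (A.hU _) (A.hPm _) (𝔄.cP k) (A.hPb _)) A.fibre57Low
    cumulant58 := cumulant58_piecesAC 𝔠.lane X 𝔖 k hk A.hμ 𝔠.kappa_ge 𝔠.C25_nonneg 𝔠.one_le_r₀ 𝔠.R₁_ge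
      𝔠.Cac_nonneg rfl rfl A.hact A.hboxm A.hbox A.hVm A.hVB A.h324a A.h324c A.hG (bound25_actAC_of_le hle k hk A)
    cumulantLower := cumulantLower_piecesAC 𝔠.lane X 𝔖 k hk A.hμ 𝔠.kappa_ge 𝔠.C25_nonneg 𝔠.one_le_r₀ 𝔠.R₁_ge
      𝔠.Cac_nonneg rfl A.hact A.hboxm A.hbox A.hVm A.hVB A.h324a A.h324c A.hG (bound25_actAC_of_le hle k hk A)
    repr33_60 := repr33_60_piecesAC 𝔠.lane X 𝔖 k hk 𝔠.chart (by linarith [𝔠.kappa_ge]) 𝔠.C25_nonneg 𝔠.C25_le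
      𝔠.κ₀_lt_half rfl A.chart A.bound28 (thresholds_of_le hle k (by omega)).2.2.2.2 (adjAct 𝔊 (P := S.P) k) A.inv26
      (hdet_adjAct 𝔊 k) A.far_le A.hPY
    vacuumWhole := vacuumWhole_piecesAC 𝔠.lane X 𝔖 k hk 𝔠.kappa_ge 𝔠.C25_nonneg 𝔠.one_le_r₀ 𝔠.R₁_ge rfl rfl A.chart
    decomp35_61 := decomp35_61_piecesAC 𝔠.lane X 𝔖 k hk 𝔠.chart rfl 𝔠.kappa_ge 𝔠.C63_nonneg 𝔠.C63_le 𝔠.one_le_r₀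
      𝔠.κ₀_lt_half 𝔠.R₁_ge rfl A.bound28 (thresholds_of_le hle k (by omega)).2.2.2.2 (adjAct 𝔊 (P := S.P) k) (hdet_adjAct 𝔊 k)
      (𝔄.Λc k) A.hPYZ
    norm35 := norm35_piecesAC 𝔠.lane X 𝔖 k 𝔠.c35_pos rfl A.norm35
    oldOutside := hOO }

/-- **BAŁABAN CMP 102 THEOREM 2 FOR THE AC TOWER, MODULO THE (α) ROWS AND C10** (the feed of the T³ socket): on the `≤`-family
`g²ε₀ ≤ (min γ₀ 1)²`, if the AC (α) rows `RunAlphaAC 𝔊 𝔠 X 𝔖 𝔄` hold and the old-terms leaf C10 holds at every step, then the densities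
`ρ_k = T^kρ₀` of the lane's AC tower `towerOfAC 𝔠.lane X 𝔖` (averaging `X.av` merely absolutely continuous; masses the exact transports; `ρ_k`
the R-RN selected version) satisfy (41) p. 266 and (47) p. 267 for every `k ≤ K`. [cite: Balaban1985UV3, Thm 2 p.272 + (41) p.266 + (47) p.267] -/
theorem ineq41_47_of_alphaAC_le (R : RunAlphaAC 𝔊 𝔠 X 𝔖 𝔄)
    (hOO : ∀ k, k + 1 ≤ S.K → OldOutside (piecesAC 𝔠.lane X 𝔖 k) 𝔠.lane.sc.C₆) (k : ℕ) (hk : k ≤ S.K) :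
    Ineq41 (towerOfAC 𝔠.lane X 𝔖) k ∧ Ineq47 (towerOfAC 𝔠.lane X 𝔖) k :=
  ineq41_47_of_residualsAC 𝔠.lane X 𝔖 (fun j hj => stepResidualsAC_of_alpha_le hle j hj (R.steps j hj) (hOO j hj)) k hk

end Alpha

/-! ## §3 C10 at the AC pieces (`LeavesOldAC`) and Theorem 2 from the (α) rows alone -/

section C10

variable (𝔎 : LaneConsts L) {S : Scales L} {G : Type} [GaugeGroup G] [MeasurableSpace G] [HaarData G]
  {V : Type} [NormedAddCommGroup V] [NormedSpace ℂ V]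
  (X : ExternalInputsAC S G) (𝔖 : ∀ k, StepSeries S G V (nblkOf S 𝔎.carrier k) k) (k : ℕ)

/-- **Row C10 AT THE AC PIECES** — p. 272 L29–31 «we estimate a sum of all terms 𝒫_j(Y_j, U_{k+1}) with localizations Y_j not contained in
Ω_{k+1} … by O(1)|Z_k|» for `piecesAC 𝔎 X 𝔖 k` with the record's `C₆` (seat p3's `AlphaCumulant.oldOutside_pieces` at the AC pieces, provider
`LeavesOldAC.oldOutside_series_gammaAC`): inputs (44) on the previous-scale terms (`h44`), the degree floor «n ≥ 2» (`hfloor`), the threshold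
`g_k ≤ γ_OO`; constants and run slots discharged. [cite: Balaban1985UV3, p.272 L29–31 + (44) p.267] -/
theorem oldOutside_piecesAC (hk : k + 1 ≤ S.K) {κ₁ B₃ C44 : ℝ} (hC : 0 ≤ C44) (hB : 0 ≤ B₃) (hκ₁ : 0 < κ₁)
    (hC₆ : 𝔎.sc.C₆ = C44 / 2 * (8 * (𝔎.F.M₁ : ℝ) ^ 6)
      * (48 / (κ₁ / 2) ^ 3 * Real.exp (κ₁ / 2 / 2) / (1 - Real.exp (-(κ₁ / 2 / 2)))) * (𝔎.F.M₁ : ℝ)⁻¹ ^ 3 * ((L : ℝ) / ((L : ℝ) - 1)))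
    (h44 : ∀ (h : Hist S.P (k + 1)) (U : GaugeField S.P (k + 1) G), ∀ j ∈ Finset.Icc 1 k,
      B10SectCExpansion.Bound44 (oldGeom S.P k j) (fun y n c => (𝔖 k).oldVal h U j y n c) κ₁ (𝔎.F.M₁ : ℝ) (ell S.P k j) (L : ℝ) B₃
        (S.gk k) (pFun 𝔎.F.b₀ 𝔎.F.p₀ (S.gk k)) C44)
    (hfloor : ∀ (h : Hist S.P (k + 1)) (U : GaugeField S.P (k + 1) G), ∀ j ∈ Finset.Icc 1 k,
      ∀ (y : Site S.P j) (n : ℕ) (c : Fin n → PBond S.P j), (𝔖 k).oldVal h U j y n c ≠ 0 → 2 ≤ n)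
    (hγOO : S.gk k ≤ Thresholds.gammaOf 𝔎.F.b₀ 𝔎.F.p₀ (1 / (2 * (8 * (L : ℝ) ^ 2 * B₃ *
        (2 / (κ₁ / (2 * 𝔎.F.M₁)) * (24 * (48 / (κ₁ / (2 * 𝔎.F.M₁) / 2) ^ 3 * Real.exp (κ₁ / (2 * 𝔎.F.M₁) / 2 / 2) /
          (1 - Real.exp (-(κ₁ / (2 * 𝔎.F.M₁) / 2 / 2)))) * 1)))))) :
    OldOutside (piecesAC 𝔎 X 𝔖 k) 𝔎.sc.C₆ := by
  rw [hC₆]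
  exact LeavesOldAC.oldOutside_series_gammaAC (X.toTowerBase 𝔎.carrier) 𝔖 (piecesParamsOf S 𝔎.carrier) k
    (by show k + 1 ≤ S.m + S.K; omega) hC hB hκ₁ 𝔎.F.M₁_pos 𝔎.F.b₀_pos 𝔎.F.p₀_pos (gk_pos S k)
    (gk_le_one S S.gK_le_one k (by omega)) h44 hfloor hγOO

end C10

section AlphaFull

variable {S : Scales L} {G : Type} [GaugeGroup G] [MeasurableSpace G] [HaarData G] {𝔊 : GroupModel G} {𝔠 : AlphaConsts L 𝔊.N}
  {X : ExternalInputsAC S G} {𝔖 : ∀ k, StepSeries S G ↥(lieC 𝔊) (nblkOf S 𝔠.lane.carrier k) k} {𝔄 : AlphaDataAC 𝔊 𝔠 X 𝔖}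
  (hle : S.g ^ 2 * S.ε₀ ≤ (min 𝔠.gamma0 1) ^ 2)
include hle

/-- **C10 AT THE AC PIECES FROM THE (α) STEP INPUTS on the `≤`-family** (rows `h44`, `hfloor`; threshold `γ_OO` from `g_k ≤ γ₀`,
`FamilyLE.thresholds_of_le`). [cite: Balaban1985UV3, p.272 L29–31 + (44) p.267] -/
theorem oldOutside_piecesAC_of_alpha_le (k : ℕ) (hk : k + 1 ≤ S.K) (A : StepAlphaAC 𝔊 𝔠 X 𝔖 𝔄 k) :
    OldOutside (piecesAC 𝔠.lane X 𝔖 k) 𝔠.lane.sc.C₆ :=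
  oldOutside_piecesAC 𝔠.lane X 𝔖 k hk 𝔠.C44_nonneg 𝔠.B₃_pos.le 𝔠.κ₁_pos rfl A.h44 A.hfloor
    (thresholds_of_le hle k (by omega)).2.2.1

/-- **THE RESIDUAL STEP LEAVES AT THE AC PIECES FROM THE (α) STEP INPUTS on the `≤`-family** — all nine, C10 included
(`stepResidualsAC_of_alpha_le` + `oldOutside_piecesAC_of_alpha_le`). [cite: Balaban1985UV3, (55)–(61) pp.269–271 + p.272] -/
theorem stepResidualsAC_of_alpha (k : ℕ) (hk : k + 1 ≤ S.K) (A : StepAlphaAC 𝔊 𝔠 X 𝔖 𝔄 k) : StepResidualsAC 𝔠.lane X 𝔖 k :=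
  stepResidualsAC_of_alpha_le hle k hk A (oldOutside_piecesAC_of_alpha_le hle k hk A)

/-- **BAŁABAN CMP 102 THEOREM 2 FOR THE AC TOWER, MODULO THE (α) ROWS** (the feed of the T³ socket `AlphaInputsT3AC`): on the `≤`-family
`g²ε₀ ≤ (min γ₀ 1)²`, if the AC (α) rows `RunAlphaAC 𝔊 𝔠 X 𝔖 𝔄` hold, then the densities `ρ_k = T^kρ₀` of the lane's AC tower
`towerOfAC 𝔠.lane X 𝔖` — averaging `X.av` merely measurable with `Ū_*(dU) ≪ dV`, masses the exact Radon–Nikodym transports, `ρ_k` the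
R-RN selected version — satisfy the inductive inequalities (41) p. 266 and (47) p. 267 for every `k ≤ K`.  Every printed constant, threshold
and bookkeeping leaf is discharged; what remains hypothesised is exactly the 31-row (α) package read at the AC objects.
[cite: Balaban1985UV3, Thm 2 p.272 + (41) p.266 + (47) p.267] -/
theorem ineq41_47_of_alphaAC (R : RunAlphaAC 𝔊 𝔠 X 𝔖 𝔄) (k : ℕ) (hk : k ≤ S.K) :
    Ineq41 (towerOfAC 𝔠.lane X 𝔖) k ∧ Ineq47 (towerOfAC 𝔠.lane X 𝔖) k :=
  ineq41_47_of_alphaAC_le hle R (fun j hj => oldOutside_piecesAC_of_alpha_le hle j hj (R.steps j hj)) k hk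

end AlphaFull

end Summit.QuantumFields.Balaban3D.Proofs.Thm2AC

end
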